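import Literature.Analysis.FluidPDE.NavierStokesReynolds
import HarnessLib

/-!
# The forced Navier–Stokes–Reynolds system on `T^d`

The *forced Navier–Stokes–Reynolds system* with viscosity `ν` and body force `f` on `T^d × S`
(`S ⊆ ℝ` a time set) is the system satisfied by a velocity `u`, a pressure `p` and a symmetric
`2`-tensor `R` (the *Reynolds stress*, stored by columns as in `Torus.IsEulerReynoldsOn`):

  `∂ₜ u + (u·∇)u + ∇p = ν Δu + f + div R`,  `div u = 0`,  `Rᵀ = R`.

It is the Navier–Stokes–Reynolds system of the convex-integration literature (Cheskidov–Luo 2022,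
§2.1 (2.1); Buckmaster–Vicol 2019, §2 (2.1); Buckmaster–Vicol 2020, §4.2) — the unforced
`Torus.IsNSReynoldsOn` — with the body force `f` of the forced Navier–Stokes system
(`Torus.IsClassicalNSSolutionOn S ν f u p`) added on the right. Read the other way round
(Buckmaster–Vicol 2020, Rem. 6.4: smooth solutions of "the Navier–Stokes equations with a `C^∞`
smooth forcing term `f^ν = div F^ν`"), a solution `(u, p, R)` is exactly a classical Navier–Stokes
solution driven by `f + div R` with `R` smooth and symmetric (`Torus.isForcedNSReynoldsOn_iff`); in
the language of De Lellis–Székelyhidi (2012, §2.2: the coarse-grained velocity solves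
`∂ₜv̄ + div (v̄ ⊗ v̄ + R) + ∇p̄ = 0` with a symmetric Reynolds stress `R`) these are the smooth
*subsolutions* of forced Navier–Stokes.

## Contents (everything proved; no named facts)

* `Torus.IsForcedNSReynoldsOn S ν f u p R` (structure) and its unfolding
  `Torus.isForcedNSReynoldsOn_iff` as `IsClassicalNSSolutionOn S ν (f + div R) u p ∧
  IsSmoothSpaceTimeOn S R ∧ R symmetric` (`isForcedNSReynoldsOn_univ_iff` on `S = univ`).
* sanity lemmas: restriction of the time set (`mono`, `mono_Icc`); `R = 0` ⇔ classical forced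
  Navier–Stokes (`isClassicalNSSolutionOn_of_stress_eq_zero`, `isForcedNSReynoldsOn_zero_stress_iff`);
  `Torus.IsNSReynoldsOn` is the case `f = 0` plus the normalisations `tr R = 0`, `∫ p = 0`, and
  `Torus.IsEulerReynoldsOn` the case `ν = 0`, `f = 0` (`isNSReynoldsOn_iff_isForcedNSReynoldsOn`,
  `isEulerReynoldsOn_iff_isForcedNSReynoldsOn`); the zero solution; divergence-form forces move
  into the stress and back (`absorb_force`, `shed_stress`); the force is jointly smooth on time
  sets of unique differentiability (`isSmoothSpaceTimeOn_force`); the trace of the stress is a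
  pressure (`absorb_trace`: `(u, p - tr R/d, R - (tr R/d) Id)` is a solution with trace-free stress).

## Design notes

* **No trace or pressure normalisation** (unlike `Torus.IsNSReynoldsOn`): the stress is only
  required symmetric, not trace free, and `p` is not normalised to zero mean — the isotropic part
  of a symmetric stress is a pressure (`div (θ Id) = ∇θ`, `absorb_trace`) and `p` enters only
  through `∇p`. This is the form in which route files state the system inline, and
  `isForcedNSReynoldsOn_iff` is that conjunction verbatim. (De Lellis–Székelyhidi put the trace
  into `q̄`; Cheskidov–Luo and Buckmaster–Vicol take `R` traceless "without loss of generality",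
  BV 2020 §4.1.)
* **The force** is a parameter on which nothing is imposed, exactly as in
  `Torus.IsClassicalNSSolutionOn`; the momentum equation determines it on `S × T^d`.
* Generality: any finite index type `d` (sources: `d = 3`, or `d ≥ 2`). Mathlib (this pin) has no
  Navier–Stokes / Reynolds-stress / subsolution notions (searched `Reynolds`, `NavierStokes`,
  `subsolution`); the calculus is the library's `Literature.Analysis.FunctionSpaces.Torus.*`.

## References

* A. Cheskidov, X. Luo, *Sharp nonuniqueness for the Navier–Stokes equations*, Invent. Math. 229
  (2022) = arXiv:2009.06596, §2.1 (2.1), Rem. 2.3. [`CheskidovLuo2022`]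
* T. Buckmaster, V. Vicol, *Nonuniqueness of weak solutions to the Navier–Stokes equation*, Ann.
  of Math. 189 (2019) = arXiv:1709.10033, §2 (2.1). [`BuckmasterVicol2019AnnMath`]
* T. Buckmaster, V. Vicol, *Convex integration and phenomenologies in turbulence*, EMS Surv.
  Math. Sci. 6 (2020) = arXiv:1901.09023, §4.1, §4.2, Rem. 6.4. [`BuckmasterVicol2020`]
* C. De Lellis, L. Székelyhidi Jr., *The h-principle and the equations of fluid dynamics*, Bull.
  AMS 49 (2012) = arXiv:1111.2700, §2.2 and Def. 2.3 (arXiv numbering). [`DeLellisSzekelyhidi2012BAMS`]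
-/

open MeasureTheory Set Topology Filter
open scoped InnerProductSpace ContDiff ENNReal NNReal

noncomputable section

namespace Literature.Analysis.FluidPDE

namespace Torus

variable {d : Type*} [Fintype d] [DecidableEq d]

section ForcedNSR

/-- Smooth (classical) solutions of the **forced Navier–Stokes–Reynolds system** with viscosity
`ν` and body force `f` on `T^d × S`, `S ⊆ ℝ` a time set: a velocity `u`, a pressure `p` and a
Reynolds stress `R` (a `2`-tensor field stored by columns, `R t x j ∈ ℝ^d`, as in
`Torus.IsEulerReynoldsOn`), all jointly `C^∞` on `S × T^d`, with
`∂ₜu + (u·∇)u + ∇p = ν Δu + f + div R` pointwise on `S × T^d` (`div R = Torus.tensorDivergence`,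
`(div R)ᵢ = ∑ⱼ ∂ⱼ Rᵢⱼ`; one-sided time derivative `Torus.timeDerivWithin S`), `div u = 0`, and `R`
symmetric. This is the Navier–Stokes–Reynolds system (Cheskidov–Luo 2022, §2.1 (2.1);
Buckmaster–Vicol 2019, §2 (2.1); 2020, §4.2), i.e. the unforced `Torus.IsNSReynoldsOn`, with the
body force `f` of `Torus.IsClassicalNSSolutionOn S ν f u p` added on the right; equivalently
(`Torus.isForcedNSReynoldsOn_iff`) a classical Navier–Stokes solution driven by `f + div R` with
`R` smooth and symmetric (Buckmaster–Vicol 2020, Rem. 6.4), a smooth subsolution in the sense of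
De Lellis–Székelyhidi (2012, §2.2). **Not imposed** (unlike `Torus.IsNSReynoldsOn`): `tr R = 0`
and `∫ p = 0` — the trace is a pressure (`IsForcedNSReynoldsOn.absorb_trace`); and nothing is
imposed on the parameter `f` (as in `Torus.IsClassicalNSSolutionOn`). [cite: CheskidovLuo2022, §2.1 (2.1)] -/
structure IsForcedNSReynoldsOn (S : Set ℝ) (ν : ℝ) (f u : ℝ → UnitAddTorus d → EuclideanSpace ℝ d)
    (p : ℝ → UnitAddTorus d → ℝ) (R : ℝ → UnitAddTorus d → d → EuclideanSpace ℝ d) : Prop where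
  /-- The velocity is jointly smooth on `S × T^d`. -/
  smooth_velocity : FunctionSpaces.Torus.IsSmoothSpaceTimeOn S u
  /-- The pressure is jointly smooth on `S × T^d`. -/
  smooth_pressure : FunctionSpaces.Torus.IsSmoothSpaceTimeOn S p
  /-- The Reynolds stress is jointly smooth on `S × T^d`. -/
  smooth_stress : FunctionSpaces.Torus.IsSmoothSpaceTimeOn S R
  /-- The momentum equation `∂ₜu + (u·∇)u + ∇p = ν Δu + f + div R` holds on `S × T^d`. -/
  momentum : ∀ t ∈ S, ∀ x,
    FunctionSpaces.Torus.timeDerivWithin S u t x + FunctionSpaces.Torus.convect (u t) (u t) x +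
        FunctionSpaces.Torus.gradient (p t) x =
      ν • FunctionSpaces.Torus.laplacian (u t) x + f t x + tensorDivergence (R t) x
  /-- Incompressibility `div u(t) = 0` for `t ∈ S`. -/
  divFree : ∀ t ∈ S, FunctionSpaces.Torus.IsDivFree (u t)
  /-- The Reynolds stress is symmetric. -/
  symm : ∀ t ∈ S, ∀ x, ∀ i j : d, R t x i j = R t x j i

variable {S S' : Set ℝ} {T ν : ℝ} {f u : ℝ → UnitAddTorus d → EuclideanSpace ℝ d}
  {p : ℝ → UnitAddTorus d → ℝ} {R Q : ℝ → UnitAddTorus d → d → EuclideanSpace ℝ d}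

/-- **The forced Navier–Stokes–Reynolds system, unfolded.** `(u, p, R)` solves the system with
force `f` on `T^d × S` iff `(u, p)` is a classical Navier–Stokes solution for the force `f + div R`
(`Torus.IsClassicalNSSolutionOn`), `R` is jointly smooth on `S × T^d`, and `R` is symmetric — the
inline form (Buckmaster–Vicol 2020, Rem. 6.4: "the Navier–Stokes equations with a `C^∞` smooth
forcing term `f^ν = div F^ν`"). The two momentum equations differ by moving `∇p` across the
equality sign. [cite: BuckmasterVicol2020, §4.2 & Rem. 6.4] -/
theorem isForcedNSReynoldsOn_iff :
    IsForcedNSReynoldsOn S ν f u p R ↔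
      FunctionSpaces.Torus.IsClassicalNSSolutionOn S ν (fun t x => f t x + tensorDivergence (R t) x) u p ∧
        FunctionSpaces.Torus.IsSmoothSpaceTimeOn S R ∧ ∀ t ∈ S, ∀ x, ∀ i j : d, R t x i j = R t x j i := by
  constructor
  · intro h
    refine ⟨⟨h.smooth_velocity, h.smooth_pressure, fun t ht x => ?_, h.divFree⟩, h.smooth_stress,
      h.symm⟩
    rw [sub_add_eq_add_sub, eq_sub_iff_add_eq, h.momentum t ht x, add_assoc]
  · rintro ⟨h, hR, hsymm⟩
    refine ⟨h.smooth_velocity, h.smooth_pressure, hR, fun t ht x => ?_, h.divFree, hsymm⟩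
    rw [h.momentum t ht x]
    abel

/-- `Torus.isForcedNSReynoldsOn_iff` on the whole time axis `S = univ`, without the membership
hypotheses and in the order "stress smooth, stress symmetric, classical solution for `f + div R`".
[cite: BuckmasterVicol2020, §4.2 & Rem. 6.4] -/
theorem isForcedNSReynoldsOn_univ_iff :
    IsForcedNSReynoldsOn univ ν f u p R ↔
      FunctionSpaces.Torus.IsSmoothSpaceTimeOn univ R ∧ (∀ t x, ∀ i j : d, R t x i j = R t x j i) ∧
        FunctionSpaces.Torus.IsClassicalNSSolutionOn univ ν (fun t x => f t x + tensorDivergence (R t) x) u p := by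
  rw [isForcedNSReynoldsOn_iff]
  simp only [mem_univ, forall_true_left]
  tauto

/-- Constructor from the unfolded form. [cite: BuckmasterVicol2020, §4.2 & Rem. 6.4] -/
theorem IsForcedNSReynoldsOn.of_isClassicalNSSolutionOn
    (h : FunctionSpaces.Torus.IsClassicalNSSolutionOn S ν (fun t x => f t x + tensorDivergence (R t) x) u p)
    (hR : FunctionSpaces.Torus.IsSmoothSpaceTimeOn S R) (hsymm : ∀ t ∈ S, ∀ x, ∀ i j : d, R t x i j = R t x j i) :
    IsForcedNSReynoldsOn S ν f u p R :=
  isForcedNSReynoldsOn_iff.2 ⟨h, hR, hsymm⟩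

/-- A solution of the forced Navier–Stokes–Reynolds system is a classical Navier–Stokes solution
for the force `f + div R`. [cite: BuckmasterVicol2020, Rem. 6.4] -/
theorem IsForcedNSReynoldsOn.isClassicalNSSolutionOn_add (h : IsForcedNSReynoldsOn S ν f u p R) :
    FunctionSpaces.Torus.IsClassicalNSSolutionOn S ν (fun t x => f t x + tensorDivergence (R t) x) u p :=
  (isForcedNSReynoldsOn_iff.1 h).1

/-- **Restriction of the time set** to any `S' ⊆ S` of unique differentiability (`S'` open, or
an interval with nonempty interior): there the one-sided time derivatives within `S'` and within
`S` agree (Mathlib `HasDerivWithinAt.mono`, `HasDerivWithinAt.derivWithin`). [folklore] -/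
theorem IsForcedNSReynoldsOn.mono (h : IsForcedNSReynoldsOn S ν f u p R) (hS' : S' ⊆ S)
    (hU : UniqueDiffOn ℝ S') : IsForcedNSReynoldsOn S' ν f u p R where
  smooth_velocity := h.smooth_velocity.mono hS'
  smooth_pressure := h.smooth_pressure.mono hS'
  smooth_stress := h.smooth_stress.mono hS'
  momentum t ht x := by
    have h1 : FunctionSpaces.Torus.timeDerivWithin S' u t x = FunctionSpaces.Torus.timeDerivWithin S u t x :=
      ((h.smooth_velocity.hasDerivWithinAt_slice (hS' ht) x).mono hS').derivWithin (hU t ht)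
    rw [h1]
    exact h.momentum t (hS' ht) x
  divFree t ht := h.divFree t (hS' ht)
  symm t ht := h.symm t (hS' ht)

/-- A solution on `S ⊇ [0, T]`, `T > 0`, is a solution on `[0, T]`. [folklore] -/
theorem IsForcedNSReynoldsOn.mono_Icc (h : IsForcedNSReynoldsOn S ν f u p R) (hS : Icc 0 T ⊆ S)
    (hT : 0 < T) : IsForcedNSReynoldsOn (Icc 0 T) ν f u p R :=
  h.mono hS (uniqueDiffOn_Icc hT)

/-- **Where the stress vanishes, a solution of the forced Navier–Stokes–Reynolds system is a
classical solution of the forced Navier–Stokes system** (same force `f`; cf. Cheskidov–Luo 2022,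
Rem. 2.3 (3): off the bad set "the solutions are exact solutions"). [cite: CheskidovLuo2022, Rem. 2.3] -/
theorem IsForcedNSReynoldsOn.isClassicalNSSolutionOn_of_stress_eq_zero
    (h : IsForcedNSReynoldsOn S ν f u p R) (hR : ∀ t ∈ S, ∀ x, R t x = 0) :
    FunctionSpaces.Torus.IsClassicalNSSolutionOn S ν f u p where
  smooth_velocity := h.smooth_velocity
  smooth_pressure := h.smooth_pressure
  momentum t ht x := by
    have hR0 : R t = fun _ _ => 0 := by
      funext y j
      rw [hR t ht y]
      rfl
    have hm := h.momentum t ht x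
    rw [hR0, tensorDivergence_zero, add_zero] at hm
    rw [sub_add_eq_add_sub, eq_sub_iff_add_eq, hm]
  divFree := h.divFree

/-- Where the stress vanishes on a subset `S' ⊆ S` of unique differentiability, `(u, p)` is a
classical forced Navier–Stokes solution on `T^d × S'`. [cite: CheskidovLuo2022, Rem. 2.3] -/
theorem IsForcedNSReynoldsOn.isClassicalNSSolutionOn_of_stress_eq_zero_on
    (h : IsForcedNSReynoldsOn S ν f u p R) (hS' : S' ⊆ S) (hU : UniqueDiffOn ℝ S')
    (hR : ∀ t ∈ S', ∀ x, R t x = 0) : FunctionSpaces.Torus.IsClassicalNSSolutionOn S' ν f u p :=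
  (h.mono hS' hU).isClassicalNSSolutionOn_of_stress_eq_zero hR

/-- **Classical forced Navier–Stokes solutions are the solutions with zero Reynolds stress.**
[folklore] -/
theorem _root_.Literature.Analysis.FunctionSpaces.Torus.IsClassicalNSSolutionOn.isForcedNSReynoldsOn_zero_stress
    (h : FunctionSpaces.Torus.IsClassicalNSSolutionOn S ν f u p) :
    IsForcedNSReynoldsOn S ν f u p (fun _ _ _ => 0) where
  smooth_velocity := h.smooth_velocity
  smooth_pressure := h.smooth_pressure
  smooth_stress := contDiffOn_const
  momentum t ht x := by
    have hm := h.momentum t ht x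
    simp only [tensorDivergence_zero, add_zero]
    rw [hm]
    abel
  divFree := h.divFree
  symm _ _ _ _ _ := rfl

/-- `(u, p, 0)` solves the forced Navier–Stokes–Reynolds system iff `(u, p)` is a classical
forced Navier–Stokes solution. [folklore] -/
theorem isForcedNSReynoldsOn_zero_stress_iff :
    IsForcedNSReynoldsOn S ν f u p (fun _ _ _ => 0) ↔ FunctionSpaces.Torus.IsClassicalNSSolutionOn S ν f u p :=
  ⟨fun h => h.isClassicalNSSolutionOn_of_stress_eq_zero fun _ _ _ => rfl,
    fun h => h.isForcedNSReynoldsOn_zero_stress⟩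

/-- **The unforced Navier–Stokes–Reynolds system is the case `f = 0` with the two
normalisations**: `Torus.IsNSReynoldsOn S ν u p R` (Cheskidov–Luo 2022, §2.1 (2.1): traceless
symmetric stress, zero-mean pressure) iff `(u, p, R)` solves the forced system with `f = 0`, `R` is
trace free and `p` has zero mean at every time of `S`. [cite: CheskidovLuo2022, §2.1 (2.1)] -/
theorem isNSReynoldsOn_iff_isForcedNSReynoldsOn :
    IsNSReynoldsOn S ν u p R ↔
      IsForcedNSReynoldsOn S ν 0 u p R ∧ (∀ t ∈ S, ∀ x, ∑ i, R t x i i = 0) ∧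
        ∀ t ∈ S, FunctionSpaces.Torus.HasZeroMean (p t) := by
  constructor
  · intro h
    exact ⟨⟨h.smooth_velocity, h.smooth_pressure, h.smooth_stress,
      fun t ht x => by simpa using h.momentum t ht x, h.divFree, h.symm⟩, h.traceFree,
      h.hasZeroMean_pressure⟩
  · rintro ⟨h, htr, hp⟩
    exact ⟨h.smooth_velocity, h.smooth_pressure, h.smooth_stress,
      fun t ht x => by simpa using h.momentum t ht x, h.divFree, h.symm, htr, hp⟩

/-- A solution of the unforced Navier–Stokes–Reynolds system solves the forced system with
`f = 0`. [cite: CheskidovLuo2022, §2.1 (2.1)] -/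
theorem IsNSReynoldsOn.isForcedNSReynoldsOn (h : IsNSReynoldsOn S ν u p R) :
    IsForcedNSReynoldsOn S ν 0 u p R :=
  (isNSReynoldsOn_iff_isForcedNSReynoldsOn.1 h).1

/-- **The inviscid unforced case is the Euler–Reynolds system**: `Torus.IsEulerReynoldsOn S u p R`
iff `(u, p, R)` solves the forced Navier–Stokes–Reynolds system with `ν = 0`, `f = 0`, `R` is
trace free and `p` has zero mean (Cheskidov–Luo 2022, §2.1: "in the inviscid case, we can just
drop the Laplacian term … the so-called Euler–Reynolds equations"; Buckmaster–Vicol 2020, §4.1).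
The *forced Euler–Reynolds system* is `IsForcedNSReynoldsOn S 0 f`. [cite: CheskidovLuo2022, §2.1] -/
theorem isEulerReynoldsOn_iff_isForcedNSReynoldsOn :
    IsEulerReynoldsOn S u p R ↔
      IsForcedNSReynoldsOn S 0 0 u p R ∧ (∀ t ∈ S, ∀ x, ∑ i, R t x i i = 0) ∧
        ∀ t ∈ S, FunctionSpaces.Torus.HasZeroMean (p t) := by
  rw [← isNSReynoldsOn_zero_iff, isNSReynoldsOn_iff_isForcedNSReynoldsOn]

/-- A solution of the Euler–Reynolds system solves the forced Navier–Stokes–Reynolds system with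
`ν = 0` and `f = 0`. [cite: BuckmasterVicol2020, §4.1] -/
theorem IsEulerReynoldsOn.isForcedNSReynoldsOn (h : IsEulerReynoldsOn S u p R) :
    IsForcedNSReynoldsOn S 0 0 u p R :=
  (isEulerReynoldsOn_iff_isForcedNSReynoldsOn.1 h).1

/-- The zero triple `(u, p, R) = (0, 0, 0)` solves the system with zero force, on every time set
and for every viscosity. [folklore] -/
theorem isForcedNSReynoldsOn_zero (S : Set ℝ) (ν : ℝ) :
    IsForcedNSReynoldsOn (d := d) S ν 0 (fun _ _ => 0) (fun _ _ => 0) (fun _ _ _ => 0) :=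
  (isNSReynoldsOn_zero S ν).isForcedNSReynoldsOn

/-! ### Moving divergence-form forces into the stress; smoothness of the force -/

omit [DecidableEq d] in
/-- The columns of a `C¹` tensor field are `C¹`. [folklore] -/
private theorem isContDiff_column {A : UnitAddTorus d → d → EuclideanSpace ℝ d}
    (hA : FunctionSpaces.Torus.IsContDiff 1 A) (j : d) : FunctionSpaces.Torus.IsContDiff 1 (fun y => A y j) :=
  (ContinuousLinearMap.proj (R := ℝ) (φ := fun _ : d => EuclideanSpace ℝ d) j).contDiff.comp hA

/-- Additivity of the tensor divergence for `C¹` tensor fields (column-wise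
`Torus.partialDeriv_add`). [folklore] -/
theorem tensorDivergence_add_of_isContDiff {A B : UnitAddTorus d → d → EuclideanSpace ℝ d}
    (hA : FunctionSpaces.Torus.IsContDiff 1 A) (hB : FunctionSpaces.Torus.IsContDiff 1 B) (x : UnitAddTorus d) :
    tensorDivergence (fun y j => A y j + B y j) x = tensorDivergence A x + tensorDivergence B x := by
  unfold tensorDivergence
  rw [← Finset.sum_add_distrib]
  refine Finset.sum_congr rfl fun j _ => ?_
  rw [show (fun y => A y j + B y j) = (fun y => A y j) + fun y => B y j from rfl,
    FunctionSpaces.Torus.partialDeriv_add (isContDiff_column hA j) (isContDiff_column hB j)]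
  rfl

/-- The divergence of the stress, `(t, x) ↦ div R(t, x)`, is jointly smooth on time sets of
unique differentiability (column-wise `IsSmoothSpaceTimeOn.partialDeriv`). [folklore] -/
theorem IsForcedNSReynoldsOn.isSmoothSpaceTimeOn_tensorDivergence_stress
    (h : IsForcedNSReynoldsOn S ν f u p R) (hU : UniqueDiffOn ℝ S) :
    FunctionSpaces.Torus.IsSmoothSpaceTimeOn S (fun t => tensorDivergence (R t)) :=
  FunctionSpaces.Torus.IsSmoothSpaceTimeOn.sum fun j _ => (h.smooth_stress.column j).partialDeriv hU j

/-- **Absorbing a divergence-form force into the stress.** If `(u, p, R)` solves the system with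
force `f + div Q` for a jointly smooth symmetric tensor `Q`, then `(u, p, R + Q)` solves it with
force `f` (Buckmaster–Vicol 2020, Rem. 6.4, read backwards). [cite: BuckmasterVicol2020, Rem. 6.4] -/
theorem IsForcedNSReynoldsOn.absorb_force
    (h : IsForcedNSReynoldsOn S ν (fun t x => f t x + tensorDivergence (Q t) x) u p R)
    (hQ : FunctionSpaces.Torus.IsSmoothSpaceTimeOn S Q) (hQsymm : ∀ t ∈ S, ∀ x, ∀ i j : d, Q t x i j = Q t x j i) :
    IsForcedNSReynoldsOn S ν f u p (fun t x j => R t x j + Q t x j) where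
  smooth_velocity := h.smooth_velocity
  smooth_pressure := h.smooth_pressure
  smooth_stress := h.smooth_stress.add hQ
  momentum t ht x := by
    rw [h.momentum t ht x,
      tensorDivergence_add_of_isContDiff ((h.smooth_stress.isSmooth_slice ht).isContDiff (by simp))
        ((hQ.isSmooth_slice ht).isContDiff (by simp))]
    abel
  divFree := h.divFree
  symm t ht x i j := by
    simp only [PiLp.add_apply]
    rw [h.symm t ht x i j, hQsymm t ht x i j]

/-- **Shedding part of the stress into the force.** If `(u, p, R + Q)` solves the system with
force `f` and `R`, `Q` are jointly smooth with `R` symmetric, then `(u, p, R)` solves it with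
force `f + div Q`; for `R = 0`, a solution `(u, p, Q)` with force `f` is a classical Navier–Stokes
solution for the force `f + div Q` (Buckmaster–Vicol 2020, Rem. 6.4). [cite: BuckmasterVicol2020, Rem. 6.4] -/
theorem IsForcedNSReynoldsOn.shed_stress
    (h : IsForcedNSReynoldsOn S ν f u p (fun t x j => R t x j + Q t x j))
    (hR : FunctionSpaces.Torus.IsSmoothSpaceTimeOn S R) (hRsymm : ∀ t ∈ S, ∀ x, ∀ i j : d, R t x i j = R t x j i)
    (hQ : FunctionSpaces.Torus.IsSmoothSpaceTimeOn S Q) :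
    IsForcedNSReynoldsOn S ν (fun t x => f t x + tensorDivergence (Q t) x) u p R where
  smooth_velocity := h.smooth_velocity
  smooth_pressure := h.smooth_pressure
  smooth_stress := hR
  momentum t ht x := by
    rw [h.momentum t ht x,
      tensorDivergence_add_of_isContDiff ((hR.isSmooth_slice ht).isContDiff (by simp))
        ((hQ.isSmooth_slice ht).isContDiff (by simp))]
    abel
  divFree := h.divFree
  symm := hRsymm

/-- **The force is jointly smooth** on a time set of unique differentiability: by the momentum
equation `f = ∂ₜu + (u·∇)u + ∇p - νΔu - div R` on `S × T^d`, each term being jointly `C^∞`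
(torus twin of `Literature.Analysis.FluidPDE.IsClassicalNSSolutionOn.isSmoothSpaceTimeOn_force`). [folklore] -/
theorem IsForcedNSReynoldsOn.isSmoothSpaceTimeOn_force (h : IsForcedNSReynoldsOn S ν f u p R)
    (hU : UniqueDiffOn ℝ S) : FunctionSpaces.Torus.IsSmoothSpaceTimeOn S f := by
  have hsm : FunctionSpaces.Torus.IsSmoothSpaceTimeOn S (fun t x =>
      FunctionSpaces.Torus.timeDerivWithin S u t x + FunctionSpaces.Torus.convect (u t) (u t) x +
        FunctionSpaces.Torus.gradient (p t) x - ν • FunctionSpaces.Torus.laplacian (u t) x -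
          tensorDivergence (R t) x) :=
    ((((h.smooth_velocity.timeDerivWithin hU).add
      (h.smooth_velocity.convect h.smooth_velocity hU)).add (h.smooth_pressure.gradient hU)).sub
        ((h.smooth_velocity.laplacian hU).const_smul ν)).sub
          (h.isSmoothSpaceTimeOn_tensorDivergence_stress hU)
  refine hsm.congr fun z hz => ?_
  obtain ⟨t, y⟩ := z
  have ht : t ∈ S := (mem_prod.1 hz).1
  simp only [FunctionSpaces.Torus.stLift_apply]
  rw [h.momentum t ht (FunctionSpaces.Torus.proj y)]
  abel

/-! ### Absorbing the trace of the stress into the pressure -/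

omit [DecidableEq d] in
/-- The gradient of a difference of `C¹` scalars. [folklore] -/
private theorem gradient_sub_of_isContDiff {φ ψ : UnitAddTorus d → ℝ}
    (hφ : FunctionSpaces.Torus.IsContDiff 1 φ) (hψ : FunctionSpaces.Torus.IsContDiff 1 ψ) (x : UnitAddTorus d) :
    FunctionSpaces.Torus.gradient (fun y => φ y - ψ y) x =
      FunctionSpaces.Torus.gradient φ x - FunctionSpaces.Torus.gradient ψ x := by
  classical
  refine ext_inner_right ℝ fun w => ?_
  have hφψ : (fun y => φ y - ψ y) = φ + (-1 : ℝ) • ψ := by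
    funext y
    simp [sub_eq_add_neg]
  rw [inner_sub_left, FunctionSpaces.Torus.inner_gradient_left, FunctionSpaces.Torus.inner_gradient_left,
    FunctionSpaces.Torus.inner_gradient_left, hφψ,
    FunctionSpaces.Torus.fderiv_add hφ (hψ.smul (-1)), FunctionSpaces.Torus.fderiv_const_smul hψ]
  simp [sub_eq_add_neg]

/-- `div (θ Id) = ∇θ` for a `C¹` scalar `θ` (column `j` of `θ Id` is `θ eⱼ`, and
`∂ⱼ (θ eⱼ) = (∂ⱼθ) eⱼ`). [folklore] -/
theorem tensorDivergence_smul_single_of_isContDiff {θ : UnitAddTorus d → ℝ}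
    (hθ : FunctionSpaces.Torus.IsContDiff 1 θ) (x : UnitAddTorus d) :
    tensorDivergence (fun y j => θ y • EuclideanSpace.single j (1 : ℝ)) x = FunctionSpaces.Torus.gradient θ x := by
  unfold tensorDivergence
  rw [FunctionSpaces.Torus.gradient_eq_sum_partialDeriv hθ]
  refine Finset.sum_congr rfl fun j _ => ?_
  rw [FunctionSpaces.Torus.partialDeriv_smul hθ (FunctionSpaces.Torus.isContDiff_const _) j x]
  simp [FunctionSpaces.Torus.partialDeriv, FunctionSpaces.Torus.lineDeriv]

/-- **The trace of the stress is a pressure.** If `(u, p, R)` solves the forced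
Navier–Stokes–Reynolds system, so does `(u, p - θ, R - θ Id)` with `θ = tr R / d` the isotropic
part of the stress, and `R - θ Id` is trace free (`div (θ Id) = ∇θ` moves across the momentum
equation). Hence trace-freeness (Cheskidov–Luo 2022, §2.1; Buckmaster–Vicol 2020, §4.1: "without
loss of generality, we will also assume `R̊_q` to be traceless"; De Lellis–Székelyhidi 2012, §2.2)
is a normalisation, not part of `Torus.IsForcedNSReynoldsOn`. (For empty `d` both corrections
vanish.) [cite: BuckmasterVicol2020, §4.1] -/
theorem IsForcedNSReynoldsOn.absorb_trace (h : IsForcedNSReynoldsOn S ν f u p R) :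
    IsForcedNSReynoldsOn S ν f u
        (fun t x => p t x - (∑ i, R t x i i) / Fintype.card d)
        (fun t x j => R t x j - ((∑ i, R t x i i) / Fintype.card d) • EuclideanSpace.single j (1 : ℝ)) ∧
      ∀ t ∈ S, ∀ x,
        ∑ j, (R t x j - ((∑ i, R t x i i) / Fintype.card d) • EuclideanSpace.single j (1 : ℝ)) j = 0 := by
  -- the isotropic part `θ = tr R / d`, smooth on `S × T^d`, and the smooth tensor `θ Id`
  set θ : ℝ → UnitAddTorus d → ℝ := fun t x => (∑ i, R t x i i) / Fintype.card d with hθ_def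
  have hθ : FunctionSpaces.Torus.IsSmoothSpaceTimeOn S θ :=
    ContDiffOn.div_const
      (FunctionSpaces.Torus.IsSmoothSpaceTimeOn.sum fun i _ => (h.smooth_stress.column i).apply i) _
  have hI : FunctionSpaces.Torus.IsSmoothSpaceTimeOn S
      (fun t x (j : d) => θ t x • EuclideanSpace.single j (1 : ℝ)) :=
    contDiffOn_pi.2 fun j =>
      hθ.smul (FunctionSpaces.Torus.isSmoothSpaceTimeOn_const (FunctionSpaces.Torus.isSmooth_const _) S)
  refine ⟨?_, fun t _ x => ?_⟩
  · refine
      { smooth_velocity := h.smooth_velocity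
        smooth_pressure := h.smooth_pressure.sub hθ
        smooth_stress := h.smooth_stress.sub hI
        momentum := fun t ht x => ?_
        divFree := h.divFree
        symm := fun t ht x i j => ?_ }
    · have hRt : FunctionSpaces.Torus.IsContDiff 1 (R t) :=
        (h.smooth_stress.isSmooth_slice ht).isContDiff (by simp)
      have hθt : FunctionSpaces.Torus.IsContDiff 1 (θ t) := (hθ.isSmooth_slice ht).isContDiff (by simp)
      have hpt : FunctionSpaces.Torus.IsContDiff 1 (p t) :=
        (h.smooth_pressure.isSmooth_slice ht).isContDiff (by simp)
      have h3 : (fun y => -θ t y) = (-1 : ℝ) • θ t := by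
        funext y
        simp
      have hnθt : FunctionSpaces.Torus.IsContDiff 1 (fun y => -θ t y) := by
        rw [h3]
        exact hθt.smul (-1)
      have hIt : FunctionSpaces.Torus.IsContDiff 1
          (fun y (j : d) => (-θ t y) • EuclideanSpace.single j (1 : ℝ)) :=
        contDiff_pi.2 fun j => ContDiff.smul hnθt contDiff_const
      -- `div (R - θ Id) = div R - ∇θ` and `∇(p - θ) = ∇p - ∇θ`
      have hdiv : tensorDivergence (fun y j => R t y j - θ t y • EuclideanSpace.single j (1 : ℝ)) x =
          tensorDivergence (R t) x - FunctionSpaces.Torus.gradient (θ t) x := by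
        have h1 : (fun y j => R t y j - θ t y • EuclideanSpace.single j (1 : ℝ)) =
            fun y j => R t y j + (-θ t y) • EuclideanSpace.single j (1 : ℝ) := by
          funext y j
          rw [neg_smul, sub_eq_add_neg]
        rw [h1, tensorDivergence_add_of_isContDiff hRt hIt, tensorDivergence_smul_single_of_isContDiff hnθt,
          h3, gradient_const_smul hθt, neg_one_smul, ← sub_eq_add_neg]
      have hm := h.momentum t ht x
      show FunctionSpaces.Torus.timeDerivWithin S u t x + FunctionSpaces.Torus.convect (u t) (u t) x +
          FunctionSpaces.Torus.gradient (fun y => p t y - θ t y) x =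
        ν • FunctionSpaces.Torus.laplacian (u t) x + f t x +
          tensorDivergence (fun y j => R t y j - θ t y • EuclideanSpace.single j (1 : ℝ)) x
      rw [gradient_sub_of_isContDiff hpt hθt x, hdiv, ← add_sub_assoc, hm]
      abel
    · show R t x i j - (θ t x • EuclideanSpace.single i (1 : ℝ)) j =
        R t x j i - (θ t x • EuclideanSpace.single j (1 : ℝ)) i
      rw [h.symm t ht x i j, PiLp.smul_apply, PiLp.smul_apply, PiLp.single_apply, PiLp.single_apply]
      by_cases hij : i = j
      · subst hij
        rfl
      · rw [if_neg hij, if_neg (Ne.symm hij)]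
  · -- the new stress is trace free
    show ∑ j, (R t x j - θ t x • EuclideanSpace.single j (1 : ℝ)) j = 0
    simp only [PiLp.sub_apply, PiLp.smul_apply, PiLp.single_apply, if_true, smul_eq_mul,
      mul_one, Finset.sum_sub_distrib, Finset.sum_const, Finset.card_univ, nsmul_eq_mul, hθ_def]
    rcases Nat.eq_zero_or_pos (Fintype.card d) with hd | hd
    · haveI : IsEmpty d := Fintype.card_eq_zero_iff.1 hd
      simp
    · rw [mul_div_cancel₀ _ (by exact_mod_cast hd.ne')]
      exact sub_self _

end ForcedNSR

end Torus

end Literature.Analysis.FluidPDE
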